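import Summits.CriticalPhenomena.PercolationContinuityZ3.Theorems.PercNearOneGluingNoHeavyLowerTailSunflowerMultiPetalModule
import Summits.CriticalPhenomena.PercolationContinuityZ3.Theorems.PercNearOneGluingNoHeavyLowerTailSunflowerMultiPetalSingleton
import HarnessLib
import HarnessLib.Audit

/-!
# `NoHeavyLowerTail` (crux stmt-CriticalPhenomena-4575), abstract sunflower cubic, `k` petals: LIFTED SUMS ALONG A ONE-PETAL MODULE —
# the two-lift (FLIP) inequality at an upper-one-petal module, the NON-BOTTOM MODULE REDUCTION of ★ₖ, and ★ₖ for every structure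
# TILED BY NON-BOTTOM MODULES (all blow-ups of the `m`-atom structure by arbitrary gadgets, every `m`)

Support file (seat `prim-l12-p2` gen 33; `--supports stmt-CriticalPhenomena-4575`; companion of `…SunflowerMultiPetalModule` (p358966/p359376:
`IsModule`, `gsum`, `glue`, `gsum_eq_sum_pattern`, `gsum_nonneg_of_isModule`) and `…SunflowerMultiPetalUpperOnePetal` (p341252: `chart4`, `uopCode`,
`uopIneqK`; imported through `…SunflowerMultiPetalSingleton`, p343107) and `…SunflowerMultiPetalRestriction` (`s6K_diag`)).  Everything here is PROVED; no `sorry`, no named fact, no new conjecture.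
Memo: run/shared/lean/prim/prim-l12/prim-l12-p2/FINDING-g33-MODULE-LIFT.md.

SETTING.  `F : MSunflower k α`, a "glue" set `M` and a window `W`; lower labels `x₀ = lab X`, glued (upper) labels `x₁ = lab (X ∪ M)` (`x₀ ≤ x₁` in `M_k`).
HYPOTHESIS (UOP): every glued label `lab (X ∪ M)`, `X ⊆ W`, lies in `{0, p, ⊤}` for ONE label `p` — e.g. `M = {e}` with `e` an upper-one-petal coordinate
(class (8) of the one-point atlas), in particular any `e` with `lab {e} ≠ 0`; or any `M` with `lab M ≠ 0` (`lab_union_cases_of_lab_ne_zero`).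

RESULTS (all `k`, every finite window `W`; the three "lifted" glued sums `gsum W G₀ G₁ G₂` of p358966 with glue `M` in 1, 2 or 3 blocks):
* POINTWISE FLIP INEQUALITY `uopLiftIneqK` (this work; `decide` on `Fin 6` codes + the four-anchor chart of p341252):
    `[x₁ dec]·kkK y₀ z₀ + [y₁ dec]·kkK x₀ z₀ + [z₁ dec]·kkK x₀ y₀ ≤ s6K x₁ y₁ z₀ + s6K x₁ y₀ z₁ + s6K x₀ y₁ z₁`
  under `x₀ ≤ x₁`, `x₁ ∈ {0,p,⊤}` (same hypotheses as `uopIneqK`).  Summed over the ordered 3-partitions of `W`, the left side is a sum of three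
  decided-spectator antipodal-Gladkov sums `≥ 0`, whence
* **`gsum_twoLift_nonneg`**: under (UOP), `0 ≤ gsum W M M ∅` (and the two block-permuted copies) — for `M = {e}` this is the `|D| = 1` coefficient of
  Conjecture G (`FlipPartitionLemmaK`, p359567) at the coordinate `e`: **the single-flip functional is nonnegative at every upper-one-petal coordinate,
  in particular at every coordinate whose singleton is a petal or kernel set** (whole-type form `0 ≤ ZKflip {e}` in the companion file
  `…SunflowerMultiPetalFlipSingleton`).  (The `|D| = 0` companion,
  (MZₖ) at such coordinates, is p341252/p343107.)
* `gsum_le_three_mul_oneLift` (glued form of (MZₖ) at an upper-one-petal coordinate): `gsum W ∅ ∅ ∅ ≤ 3 · gsum W M ∅ ∅`;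
  `gsum_threeLift_nonneg`: `0 ≤ gsum W M M M` (at most one petal among three glued labels).
* **NON-BOTTOM MODULE REDUCTION `gsum_nonneg_of_isModule_of_upper`**: if `(M, g)` is a module of `F` (p358966) with `M ⊆ W` satisfying (UOP) on `W ∖ M`,
  then `0 ≤ gsum (W ∖ M) ∅ ∅ ∅ → 0 ≤ gsum W ∅ ∅ ∅`: by the module identity `gsum W = Σ_P N(P)·C(P)` all eight lifted sums `C(P)` are nonnegative
  (`P = ∅`: hypothesis; `#P = 1`: glued (MZₖ); `#P = 2`: the flip inequality; `#P = 3`: three-lift).  Whole type: `ZK_nonneg_of_isModule_of_upper`,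
  `ZK_nonneg_of_isModule_of_lab_ne_zero`.  So a minimal counterexample to ★ₖ has NO module whose own label `lab M` is a petal or the top.
* **★ₖ FOR STRUCTURES TILED BY NON-BOTTOM MODULES** (`gsum_biUnion_nonneg_of_modules`, `ZK_nonneg_of_modules_cover`): if `univ` is a disjoint union of
  modules `M_i` with `lab M_i ≠ 0`, then `0 ≤ ZK`.  This contains every BLOW-UP OF THE `m`-ATOM STRUCTURE `θ_m` (labels: no territory firing ↦ bottom, exactly
  territory `i` firing ↦ petal `i`, two or more ↦ top) by arbitrary monotone gadgets on pairwise disjoint territories, for EVERY `m` — all 'products'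
  with any number of colours (coloured matchings, `P_n`, disjoint unions of monochromatic clutters, …); previously in the tree only for quotients on
  `≤ 3` points (`…ModuleThresholdTwo`, p360735) and by census for quotients on `≤ 6` points.
-/

namespace Summit.CriticalPhenomena.PercolationContinuityZ3.Theorems.SunflowerPartition

open Finset

/-! ## Symmetries of the kernel `s6K` -/

/-- `s6K` is symmetric in its first two arguments. [this work] -/
theorem s6K_swap12 (k : ℕ) (x y z : Fin (k + 2)) : s6K k y x z = s6K k x y z := by
  unfold s6K
  rw [if_congr (show (y ≠ x ∧ x ≠ z ∧ y ≠ z) ↔ (x ≠ y ∧ y ≠ z ∧ x ≠ z) from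
    ⟨fun h => ⟨fun e => h.1 e.symm, h.2.2, h.2.1⟩, fun h => ⟨fun e => h.1 e.symm, h.2.2, h.2.1⟩⟩) (Eq.refl (1 : ℤ)) (Eq.refl (0 : ℤ))]
  ring

/-- `s6K` is symmetric in its last two arguments. [this work] -/
theorem s6K_swap23 (k : ℕ) (x y z : Fin (k + 2)) : s6K k x z y = s6K k x y z := by
  unfold s6K
  rw [if_congr (show (x ≠ z ∧ z ≠ y ∧ x ≠ y) ↔ (x ≠ y ∧ y ≠ z ∧ x ≠ z) from
    ⟨fun h => ⟨h.2.2, fun e => h.2.1 e.symm, h.1⟩, fun h => ⟨h.2.2, fun e => h.2.1 e.symm, h.1⟩⟩) (Eq.refl (1 : ℤ)) (Eq.refl (0 : ℤ))]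
  ring

/-! ## Pointwise: the two-lift (flip) kernel inequality and the three-lift sign -/

/-- The two-lift kernel inequality on `Fin 6` codes (`decide`). [this work] -/
theorem uopFlipIneq6 : ∀ x0 x1 y0 y1 z0 z1 : Fin 6, uopCode x0 x1 = true → uopCode y0 y1 = true → uopCode z0 z1 = true →
    decK 4 x1 * kkK 4 y0 z0 + decK 4 y1 * kkK 4 x0 z0 + decK 4 z1 * kkK 4 x0 y0
      ≤ s6K 4 x1 y1 z0 + s6K 4 x1 y0 z1 + s6K 4 x0 y1 z1 := by
  decide

/-- The three-lift kernel sign on `Fin 6` codes: three labels in `{0, 1, 5}` have a nonnegative kernel (`decide`). [this work] -/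
theorem uopThreeIneq6 : ∀ x0 x1 y0 y1 z0 z1 : Fin 6, uopCode x0 x1 = true → uopCode y0 y1 = true → uopCode z0 z1 = true →
    0 ≤ s6K 4 x1 y1 z1 := by
  decide

/-- **The lift inequalities for every `k`**: for label chains `x₀ ≤ x₁`, `y₀ ≤ y₁`, `z₀ ≤ z₁` in `M_k` whose upper labels lie in
`{0, p, ⊤}` for one label `p`: (i) the two-lift (FLIP) kernel inequality
`[x₁ dec]·kkK y₀ z₀ + [y₁ dec]·kkK x₀ z₀ + [z₁ dec]·kkK x₀ y₀ ≤ s6K x₁ y₁ z₀ + s6K x₁ y₀ z₁ + s6K x₀ y₁ z₁`, and (ii) the three-lift sign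
`0 ≤ s6K x₁ y₁ z₁` (chart `p ↦ 1`, `x₀ ↦ 2`, `y₀ ↦ 3`, transported from the `Fin 6` cores). [this work] -/
theorem uopLiftIneqK {k : ℕ} (p x0 x1 y0 y1 z0 z1 : Fin (k + 2))
    (hx : x0 = x1 ∨ x0 = 0 ∨ x1 = Fin.last (k + 1)) (hy : y0 = y1 ∨ y0 = 0 ∨ y1 = Fin.last (k + 1))
    (hz : z0 = z1 ∨ z0 = 0 ∨ z1 = Fin.last (k + 1))
    (hx1 : x1 = 0 ∨ x1 = p ∨ x1 = Fin.last (k + 1)) (hy1 : y1 = 0 ∨ y1 = p ∨ y1 = Fin.last (k + 1))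
    (hz1 : z1 = 0 ∨ z1 = p ∨ z1 = Fin.last (k + 1)) :
    (decK k x1 * kkK k y0 z0 + decK k y1 * kkK k x0 z0 + decK k z1 * kkK k x0 y0
      ≤ s6K k x1 y1 z0 + s6K k x1 y0 z1 + s6K k x0 y1 z1) ∧ 0 ≤ s6K k x1 y1 z1 := by
  set c := chart4 k p x0 y0 with hc
  have e5 : (5 : Fin 6) = Fin.last (4 + 1) := rfl
  have T := fun w => e5 ▸ (chart4_eq_five_iff k p x0 y0 w).symm
  have Zr := fun w => (chart4_eq_zero_iff k p x0 y0 w).symm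
  have nX0 : x0 ≠ Fin.last (k + 1) → x0 ≠ 0 → x0 ≠ p → x0 ≠ x0 → x0 ≠ y0 → False := fun _ _ _ h _ => h rfl
  have nY0 : y0 ≠ Fin.last (k + 1) → y0 ≠ 0 → y0 ≠ p → y0 ≠ x0 → y0 ≠ y0 → False := fun _ _ _ _ h => h rfl
  have nU : ∀ {u : Fin (k + 2)}, (u = 0 ∨ u = p ∨ u = Fin.last (k + 1)) →
      (u ≠ Fin.last (k + 1) → u ≠ 0 → u ≠ p → u ≠ x0 → u ≠ y0 → False) := by
    intro u hu ht h0 hp _ _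
    rcases hu with h | h | h
    · exact h0 h
    · exact hp h
    · exact ht h
  have E1 : ∀ {w w' : Fin (k + 2)}, (w ≠ Fin.last (k + 1) → w ≠ 0 → w ≠ p → w ≠ x0 → w ≠ y0 → False) → (w = w' ↔ c w = c w') :=
    fun hw => chart4_eq_iff k p x0 y0 (fun a b d g i _ _ _ _ _ => (hw a b d g i).elim)
  have E2 : ∀ {w w' : Fin (k + 2)}, (w' ≠ Fin.last (k + 1) → w' ≠ 0 → w' ≠ p → w' ≠ x0 → w' ≠ y0 → False) → (w = w' ↔ c w = c w') :=
    fun hw => chart4_eq_iff k p x0 y0 (fun _ _ _ _ _ a b d g i => (hw a b d g i).elim)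
  have cp : p ≠ Fin.last (k + 1) → p ≠ 0 → c p = 1 := by
    intro h1 h2; show chart4 k p x0 y0 p = 1; unfold chart4; simp [h1, h2]
  have up : ∀ {u : Fin (k + 2)}, (u = 0 ∨ u = p ∨ u = Fin.last (k + 1)) → (c u = 0 ∨ c u = 1 ∨ c u = 5) := by
    intro u hu
    rcases hu with h | h | h
    · exact Or.inl ((Zr u).1 h)
    · by_cases h1 : p = Fin.last (k + 1)
      · exact Or.inr (Or.inr (e5 ▸ (T u).1 (h.trans h1)))
      by_cases h2 : p = 0
      · exact Or.inl ((Zr u).1 (h.trans h2))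
      · exact Or.inr (Or.inl (h ▸ cp h1 h2))
    · exact Or.inr (Or.inr (e5 ▸ (T u).1 h))
  have lo : ∀ {u v : Fin (k + 2)}, (u ≠ Fin.last (k + 1) → u ≠ 0 → u ≠ p → u ≠ x0 → u ≠ y0 → False) →
      (u = v ∨ u = 0 ∨ v = Fin.last (k + 1)) → (c u = c v ∨ c u = 0 ∨ c v = 5) := by
    intro u v hu h
    rcases h with h | h | h
    · exact Or.inl ((E1 hu).1 h)
    · exact Or.inr (Or.inl ((Zr u).1 h))
    · exact Or.inr (Or.inr (e5 ▸ (T v).1 h))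
  have loz : c z0 = c z1 ∨ c z0 = 0 ∨ c z1 = 5 := by
    rcases hz with h | h | h
    · exact Or.inl ((E2 (nU hz1)).1 h)
    · exact Or.inr (Or.inl ((Zr z0).1 h))
    · exact Or.inr (Or.inr (e5 ▸ (T z1).1 h))
  have cx := uopCode_of _ _ (lo nX0 hx) (up hx1)
  have cy := uopCode_of _ _ (lo nY0 hy) (up hy1)
  have cz := uopCode_of _ _ loz (up hz1)
  refine ⟨?_, ?_⟩
  · rw [decK_congr (T x1) (Zr x1), kkK_congr (T y0) (Zr y0) (T z0) (Zr z0) (E1 nY0),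
      decK_congr (T y1) (Zr y1), kkK_congr (T x0) (Zr x0) (T z0) (Zr z0) (E1 nX0),
      decK_congr (T z1) (Zr z1), kkK_congr (T x0) (Zr x0) (T y0) (Zr y0) (E1 nX0),
      s6K_congr (T x1) (Zr x1) (T y1) (Zr y1) (T z0) (Zr z0) (E1 (nU hx1)) (E1 (nU hy1)) (E1 (nU hx1)),
      s6K_congr (T x1) (Zr x1) (T y0) (Zr y0) (T z1) (Zr z1) (E1 (nU hx1)) (E1 nY0) (E1 (nU hx1)),
      s6K_congr (T x0) (Zr x0) (T y1) (Zr y1) (T z1) (Zr z1) (E1 nX0) (E1 (nU hy1)) (E1 nX0)]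
    exact uopFlipIneq6 _ _ _ _ _ _ cx cy cz
  · rw [s6K_congr (T x1) (Zr x1) (T y1) (Zr y1) (T z1) (Zr z1) (E1 (nU hx1)) (E1 (nU hy1)) (E1 (nU hx1))]
    exact uopThreeIneq6 _ _ _ _ _ _ cx cy cz

/-! ## Glued sums: block symmetries and the decided-spectator Gladkov sums -/

variable {α : Type*} [DecidableEq α]

namespace MSunflower

variable {k : ℕ} (F : MSunflower k α)

/-- Glued sums are symmetric under swapping the first two blocks (with their glue). [this work] -/
theorem gsum_swap12 (W G₀ G₁ G₂ : Finset α) : F.gsum W G₀ G₁ G₂ = F.gsum W G₁ G₀ G₂ := by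
  unfold gsum
  have h : ∑ r ∈ partsOf W, s6K k (F.lab (r.1 ∪ G₀)) (F.lab (r.2 ∪ G₁)) (F.lab ((W \ (r.1 ∪ r.2)) ∪ G₂))
      = ∑ r ∈ partsOf W, s6K k (F.lab (r.2 ∪ G₀)) (F.lab (r.1 ∪ G₁)) (F.lab ((W \ (r.1 ∪ r.2)) ∪ G₂)) :=
    sum_partsOf_swap12 W (fun a b d => s6K k (F.lab (a ∪ G₀)) (F.lab (b ∪ G₁)) (F.lab (d ∪ G₂)))
  rw [h]
  exact sum_congr rfl fun r _ => (s6K_swap12 k _ _ _).symm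

/-- Glued sums are symmetric under swapping the last two blocks (with their glue). [this work] -/
theorem gsum_swap23 (W G₀ G₁ G₂ : Finset α) : F.gsum W G₀ G₁ G₂ = F.gsum W G₀ G₂ G₁ := by
  unfold gsum
  have h : ∑ r ∈ partsOf W, s6K k (F.lab (r.1 ∪ G₀)) (F.lab (r.2 ∪ G₁)) (F.lab ((W \ (r.1 ∪ r.2)) ∪ G₂))
      = ∑ r ∈ partsOf W, s6K k (F.lab (r.1 ∪ G₀)) (F.lab ((W \ (r.1 ∪ r.2)) ∪ G₁)) (F.lab (r.2 ∪ G₂)) :=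
    sum_partsOf_swap23 W (fun a b d => s6K k (F.lab (a ∪ G₀)) (F.lab (b ∪ G₁)) (F.lab (d ∪ G₂)))
  rw [h]
  exact sum_congr rfl fun r _ => (s6K_swap23 k _ _ _).symm

/-- The decided-spectator Gladkov sum with the spectator (first block) glued: `0 ≤ Σ_{(X,Y,Z) ⊢ W} [lab (X ∪ M) dec]·kkK (lab Y) (lab Z)`
(antipodal Gladkov on `W ∖ X` behind every first block). [this work] -/
theorem sum_partsOf_dec_kkK_nonneg (W M : Finset α) :
    0 ≤ ∑ r ∈ partsOf W, decK k (F.lab (r.1 ∪ M)) * kkK k (F.lab r.2) (F.lab (W \ (r.1 ∪ r.2))) := by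
  rw [sum_partsOf_eq_sum_powerset W (fun X Y => decK k (F.lab (X ∪ M)) * kkK k (F.lab Y) (F.lab (W \ (X ∪ Y))))]
  refine sum_nonneg fun X _ => ?_
  rw [← mul_sum]
  refine mul_nonneg (by unfold decK; split_ifs <;> norm_num) ?_
  have h := F.antipodal_gladkov (W \ X)
  refine le_of_le_of_eq h (sum_congr rfl fun Y _ => ?_)
  rw [sdiff_sdiff_left, sup_eq_union]

/-! ## The three lifted sums under the one-petal hypothesis -/

/-- **Glued (MZₖ)**: under (UOP) the unglued sum is at most the sum of the three one-lift sums. [this work] -/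
theorem gsum_le_oneLift_sum (W M : Finset α) (p : Fin (k + 2))
    (hup : ∀ X ⊆ W, F.lab (X ∪ M) = 0 ∨ F.lab (X ∪ M) = p ∨ F.lab (X ∪ M) = Fin.last (k + 1)) :
    F.gsum W ∅ ∅ ∅ ≤ F.gsum W M ∅ ∅ + F.gsum W ∅ M ∅ + F.gsum W ∅ ∅ M := by
  have g1 := F.sum_partsOf_dec_kkK_nonneg W M
  have g2 : 0 ≤ ∑ r ∈ partsOf W, decK k (F.lab (r.2 ∪ M)) * kkK k (F.lab r.1) (F.lab (W \ (r.1 ∪ r.2))) := by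
    have h : ∑ r ∈ partsOf W, decK k (F.lab (r.2 ∪ M)) * kkK k (F.lab r.1) (F.lab (W \ (r.1 ∪ r.2)))
        = ∑ r ∈ partsOf W, decK k (F.lab (r.1 ∪ M)) * kkK k (F.lab r.2) (F.lab (W \ (r.1 ∪ r.2))) :=
      sum_partsOf_swap12 W (fun a b d => decK k (F.lab (b ∪ M)) * kkK k (F.lab a) (F.lab d))
    rw [h]; exact g1
  have g3 : 0 ≤ ∑ r ∈ partsOf W, decK k (F.lab ((W \ (r.1 ∪ r.2)) ∪ M)) * kkK k (F.lab r.1) (F.lab r.2) := by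
    have h : ∑ r ∈ partsOf W, decK k (F.lab ((W \ (r.1 ∪ r.2)) ∪ M)) * kkK k (F.lab r.1) (F.lab r.2)
        = ∑ r ∈ partsOf W, decK k (F.lab (r.1 ∪ M)) * kkK k (F.lab (W \ (r.1 ∪ r.2))) (F.lab r.2) :=
      sum_partsOf_swap13 W (fun a b d => decK k (F.lab (d ∪ M)) * kkK k (F.lab a) (F.lab b))
    rw [h]
    refine le_of_le_of_eq g1 (sum_congr rfl fun r _ => ?_)
    rw [kkK_comm k (F.lab r.2)]
  unfold gsum
  simp only [union_empty]
  rw [← sum_add_distrib, ← sum_add_distrib]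
  have key : ∑ r ∈ partsOf W, s6K k (F.lab r.1) (F.lab r.2) (F.lab (W \ (r.1 ∪ r.2)))
      + ∑ r ∈ partsOf W, decK k (F.lab (r.1 ∪ M)) * kkK k (F.lab r.2) (F.lab (W \ (r.1 ∪ r.2)))
      + ∑ r ∈ partsOf W, decK k (F.lab (r.2 ∪ M)) * kkK k (F.lab r.1) (F.lab (W \ (r.1 ∪ r.2)))
      + ∑ r ∈ partsOf W, decK k (F.lab ((W \ (r.1 ∪ r.2)) ∪ M)) * kkK k (F.lab r.1) (F.lab r.2)
      ≤ ∑ r ∈ partsOf W, (s6K k (F.lab (r.1 ∪ M)) (F.lab r.2) (F.lab (W \ (r.1 ∪ r.2)))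
          + s6K k (F.lab r.1) (F.lab (r.2 ∪ M)) (F.lab (W \ (r.1 ∪ r.2)))
          + s6K k (F.lab r.1) (F.lab r.2) (F.lab ((W \ (r.1 ∪ r.2)) ∪ M))) := by
    rw [← sum_add_distrib, ← sum_add_distrib, ← sum_add_distrib]
    refine sum_le_sum fun r hr => ?_
    obtain ⟨h1, h2, -⟩ := (Sunflower.mem_partsOf_iff).1 hr
    have h3 : W \ (r.1 ∪ r.2) ⊆ W := sdiff_subset
    have := uopIneqK p _ _ _ _ _ _ (F.lab_mono (subset_union_left (s₂ := M) (s₁ := r.1)))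
      (F.lab_mono (subset_union_left (s₂ := M) (s₁ := r.2))) (F.lab_mono (subset_union_left (s₂ := M) (s₁ := W \ (r.1 ∪ r.2))))
      (hup _ h1) (hup _ h2) (hup _ h3)
    linarith
  linarith

/-- **The two-lift (flip) inequality, summed form**: under (UOP) the sum of the three two-lift glued sums is nonnegative. [this work] -/
theorem gsum_twoLift_sum_nonneg (W M : Finset α) (p : Fin (k + 2))
    (hup : ∀ X ⊆ W, F.lab (X ∪ M) = 0 ∨ F.lab (X ∪ M) = p ∨ F.lab (X ∪ M) = Fin.last (k + 1)) :
    0 ≤ F.gsum W M M ∅ + F.gsum W M ∅ M + F.gsum W ∅ M M := by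
  have g1 := F.sum_partsOf_dec_kkK_nonneg W M
  have g2 : 0 ≤ ∑ r ∈ partsOf W, decK k (F.lab (r.2 ∪ M)) * kkK k (F.lab r.1) (F.lab (W \ (r.1 ∪ r.2))) := by
    have h : ∑ r ∈ partsOf W, decK k (F.lab (r.2 ∪ M)) * kkK k (F.lab r.1) (F.lab (W \ (r.1 ∪ r.2)))
        = ∑ r ∈ partsOf W, decK k (F.lab (r.1 ∪ M)) * kkK k (F.lab r.2) (F.lab (W \ (r.1 ∪ r.2))) :=
      sum_partsOf_swap12 W (fun a b d => decK k (F.lab (b ∪ M)) * kkK k (F.lab a) (F.lab d))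
    rw [h]; exact g1
  have g3 : 0 ≤ ∑ r ∈ partsOf W, decK k (F.lab ((W \ (r.1 ∪ r.2)) ∪ M)) * kkK k (F.lab r.1) (F.lab r.2) := by
    have h : ∑ r ∈ partsOf W, decK k (F.lab ((W \ (r.1 ∪ r.2)) ∪ M)) * kkK k (F.lab r.1) (F.lab r.2)
        = ∑ r ∈ partsOf W, decK k (F.lab (r.1 ∪ M)) * kkK k (F.lab (W \ (r.1 ∪ r.2))) (F.lab r.2) :=
      sum_partsOf_swap13 W (fun a b d => decK k (F.lab (d ∪ M)) * kkK k (F.lab a) (F.lab b))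
    rw [h]
    refine le_of_le_of_eq g1 (sum_congr rfl fun r _ => ?_)
    rw [kkK_comm k (F.lab r.2)]
  unfold gsum
  simp only [union_empty]
  rw [← sum_add_distrib, ← sum_add_distrib]
  have key : ∑ r ∈ partsOf W, decK k (F.lab (r.1 ∪ M)) * kkK k (F.lab r.2) (F.lab (W \ (r.1 ∪ r.2)))
      + ∑ r ∈ partsOf W, decK k (F.lab (r.2 ∪ M)) * kkK k (F.lab r.1) (F.lab (W \ (r.1 ∪ r.2)))
      + ∑ r ∈ partsOf W, decK k (F.lab ((W \ (r.1 ∪ r.2)) ∪ M)) * kkK k (F.lab r.1) (F.lab r.2)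
      ≤ ∑ r ∈ partsOf W, (s6K k (F.lab (r.1 ∪ M)) (F.lab (r.2 ∪ M)) (F.lab (W \ (r.1 ∪ r.2)))
          + s6K k (F.lab (r.1 ∪ M)) (F.lab r.2) (F.lab ((W \ (r.1 ∪ r.2)) ∪ M))
          + s6K k (F.lab r.1) (F.lab (r.2 ∪ M)) (F.lab ((W \ (r.1 ∪ r.2)) ∪ M))) := by
    rw [← sum_add_distrib, ← sum_add_distrib]
    refine sum_le_sum fun r hr => ?_
    obtain ⟨h1, h2, -⟩ := (Sunflower.mem_partsOf_iff).1 hr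
    have h3 : W \ (r.1 ∪ r.2) ⊆ W := sdiff_subset
    exact (uopLiftIneqK p _ _ _ _ _ _ (F.lab_mono (subset_union_left (s₂ := M) (s₁ := r.1)))
      (F.lab_mono (subset_union_left (s₂ := M) (s₁ := r.2))) (F.lab_mono (subset_union_left (s₂ := M) (s₁ := W \ (r.1 ∪ r.2))))
      (hup _ h1) (hup _ h2) (hup _ h3)).1
  linarith

/-- **The two-lift (FLIP) inequality**: under (UOP), `0 ≤ gsum W M M ∅`.  For `M = {e}` this is (one third of) the `|D| = 1` coefficient
`Z_{{e}}` of Conjecture G at `e`, restricted to the window `W + e`. [this work] -/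
theorem gsum_twoLift_nonneg (W M : Finset α) (p : Fin (k + 2))
    (hup : ∀ X ⊆ W, F.lab (X ∪ M) = 0 ∨ F.lab (X ∪ M) = p ∨ F.lab (X ∪ M) = Fin.last (k + 1)) :
    0 ≤ F.gsum W M M ∅ := by
  have h := F.gsum_twoLift_sum_nonneg W M p hup
  rw [F.gsum_swap23 W M ∅ M, F.gsum_swap12 W ∅ M M, F.gsum_swap23 W M ∅ M] at h
  linarith

/-- **Glued (MZₖ), single block**: under (UOP), `gsum W ∅ ∅ ∅ ≤ 3 · gsum W M ∅ ∅`. [this work] -/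
theorem gsum_le_three_mul_oneLift (W M : Finset α) (p : Fin (k + 2))
    (hup : ∀ X ⊆ W, F.lab (X ∪ M) = 0 ∨ F.lab (X ∪ M) = p ∨ F.lab (X ∪ M) = Fin.last (k + 1)) :
    F.gsum W ∅ ∅ ∅ ≤ 3 * F.gsum W M ∅ ∅ := by
  have h := F.gsum_le_oneLift_sum W M p hup
  rw [F.gsum_swap12 W ∅ M ∅, F.gsum_swap23 W ∅ ∅ M, F.gsum_swap12 W ∅ M ∅] at h
  linarith

/-- **The three-lift sign**: under (UOP), `0 ≤ gsum W M M M`. [this work] -/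
theorem gsum_threeLift_nonneg (W M : Finset α) (p : Fin (k + 2))
    (hup : ∀ X ⊆ W, F.lab (X ∪ M) = 0 ∨ F.lab (X ∪ M) = p ∨ F.lab (X ∪ M) = Fin.last (k + 1)) :
    0 ≤ F.gsum W M M M := by
  unfold gsum
  refine sum_nonneg fun r hr => ?_
  obtain ⟨h1, h2, -⟩ := (Sunflower.mem_partsOf_iff).1 hr
  have h3 : W \ (r.1 ∪ r.2) ⊆ W := sdiff_subset
  exact (uopLiftIneqK p _ _ _ _ _ _ (F.lab_mono (subset_union_left (s₂ := M) (s₁ := r.1)))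
    (F.lab_mono (subset_union_left (s₂ := M) (s₁ := r.2))) (F.lab_mono (subset_union_left (s₂ := M) (s₁ := W \ (r.1 ∪ r.2))))
    (hup _ h1) (hup _ h2) (hup _ h3)).2

/-- If `lab M ≠ 0` then every glued label `lab (X ∪ M)` lies in `{0, lab M, ⊤}` (in fact in `{lab M, ⊤}`): (UOP) with `p = lab M`. [this work] -/
theorem lab_union_cases_of_lab_ne_zero (M X : Finset α) (h : F.lab M ≠ 0) :
    F.lab (X ∪ M) = 0 ∨ F.lab (X ∪ M) = F.lab M ∨ F.lab (X ∪ M) = Fin.last (k + 1) := by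
  rcases F.lab_mono (subset_union_right (s₁ := X) (s₂ := M)) with h1 | h1 | h1
  · exact Or.inr (Or.inl h1.symm)
  · exact absurd h1 h
  · exact Or.inr (Or.inr h1)

/-! ## The non-bottom module reduction -/

/-- **NON-BOTTOM (one-petal) MODULE REDUCTION**: for a module `(M, g)` with `M ⊆ W` whose glued labels on `W ∖ M` lie in `{0, p, ⊤}`,
`0 ≤ gsum (W ∖ M) ∅ ∅ ∅` implies `0 ≤ gsum W ∅ ∅ ∅` — all eight lifted sums of the module identity are nonnegative. [this work] -/
theorem gsum_nonneg_of_isModule_of_upper {M : Finset α} {g : Finset α → Bool} (hF : F.IsModule M g) {W : Finset α}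
    (hMW : M ⊆ W) (p : Fin (k + 2))
    (hup : ∀ X ⊆ W \ M, F.lab (X ∪ M) = 0 ∨ F.lab (X ∪ M) = p ∨ F.lab (X ∪ M) = Fin.last (k + 1))
    (h0 : 0 ≤ F.gsum (W \ M) ∅ ∅ ∅) : 0 ≤ F.gsum W ∅ ∅ ∅ := by
  have h1 : 0 ≤ F.gsum (W \ M) M ∅ ∅ := by
    have := F.gsum_le_three_mul_oneLift (W \ M) M p hup; linarith
  have h2 : 0 ≤ F.gsum (W \ M) M M ∅ := F.gsum_twoLift_nonneg (W \ M) M p hup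
  have h3 : 0 ≤ F.gsum (W \ M) M M M := F.gsum_threeLift_nonneg (W \ M) M p hup
  refine F.gsum_nonneg_of_isModule hF hMW (disjoint_empty_left M) (disjoint_empty_left M) (disjoint_empty_left M) fun P => ?_
  rw [empty_union, empty_union, empty_union]
  unfold glue
  by_cases a0 : (0 : Fin 3) ∈ P <;> by_cases a1 : (1 : Fin 3) ∈ P <;> by_cases a2 : (2 : Fin 3) ∈ P <;>
    simp only [a0, a1, a2, if_true, if_false]
  · exact h3
  · exact h2
  · rw [← F.gsum_swap23 (W \ M) M M ∅]; exact h2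
  · exact h1
  · rw [F.gsum_swap12 (W \ M) ∅ M M, ← F.gsum_swap23 (W \ M) M M ∅]; exact h2
  · rw [F.gsum_swap12 (W \ M) ∅ M ∅]; exact h1
  · rw [F.gsum_swap23 (W \ M) ∅ ∅ M, F.gsum_swap12 (W \ M) ∅ M ∅]; exact h1
  · exact h0

/-- Whole-type form: a module `(M, g)` with one-petal glued labels reduces ★ₖ for `F` to the window `Mᶜ`. [this work] -/
theorem ZK_nonneg_of_isModule_of_upper [Fintype α] {M : Finset α} {g : Finset α → Bool} (hF : F.IsModule M g) (p : Fin (k + 2))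
    (hup : ∀ X ⊆ Mᶜ, F.lab (X ∪ M) = 0 ∨ F.lab (X ∪ M) = p ∨ F.lab (X ∪ M) = Fin.last (k + 1))
    (h0 : 0 ≤ F.gsum Mᶜ ∅ ∅ ∅) : 0 ≤ F.ZK := by
  rw [F.ZK_eq_gsum]
  rw [compl_eq_univ_sdiff] at hup h0
  exact F.gsum_nonneg_of_isModule_of_upper hF (subset_univ M) p hup h0

/-- **A minimal counterexample to ★ₖ has no non-bottom module**: if `(M, g)` is a module with `lab M ≠ 0` and ★ₖ holds on the window `Mᶜ`
(`0 ≤ gsum Mᶜ ∅ ∅ ∅`), then `0 ≤ ZK`. [this work] -/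
theorem ZK_nonneg_of_isModule_of_lab_ne_zero [Fintype α] {M : Finset α} {g : Finset α → Bool} (hF : F.IsModule M g)
    (hM : F.lab M ≠ 0) (h0 : 0 ≤ F.gsum Mᶜ ∅ ∅ ∅) : 0 ≤ F.ZK :=
  F.ZK_nonneg_of_isModule_of_upper hF (F.lab M) (fun X _ => F.lab_union_cases_of_lab_ne_zero M X hM) h0

/-! ## ★ₖ for structures tiled by non-bottom modules (all blow-ups of the `m`-atom structure, every `m`) -/

/-- **Tiling theorem (window form)**: if `W` is a disjoint union of modules `M i`, `i ∈ s`, each with `lab (M i) ≠ 0`, then `0 ≤ gsum W ∅ ∅ ∅`. [this work] -/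
theorem gsum_biUnion_nonneg_of_modules {ι : Type*} [DecidableEq ι] (s : Finset ι) (M : ι → Finset α) (g : ι → (Finset α → Bool))
    (hmod : ∀ i ∈ s, F.IsModule (M i) (g i)) (hlab : ∀ i ∈ s, F.lab (M i) ≠ 0)
    (hdisj : ∀ i ∈ s, ∀ j ∈ s, i ≠ j → Disjoint (M i) (M j)) :
    0 ≤ F.gsum (s.biUnion M) ∅ ∅ ∅ := by
  induction s using Finset.induction_on with
  | empty =>
    rw [biUnion_empty, F.gsum_empty]
    exact le_of_eq (s6K_diag k _).symm
  | insert i s hi ih =>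
    have hmod' : ∀ j ∈ s, F.IsModule (M j) (g j) := fun j hj => hmod j (mem_insert_of_mem hj)
    have hlab' : ∀ j ∈ s, F.lab (M j) ≠ 0 := fun j hj => hlab j (mem_insert_of_mem hj)
    have hdisj' : ∀ j ∈ s, ∀ j' ∈ s, j ≠ j' → Disjoint (M j) (M j') :=
      fun j hj j' hj' hne => hdisj j (mem_insert_of_mem hj) j' (mem_insert_of_mem hj') hne
    have ih' := ih hmod' hlab' hdisj'
    have hd : Disjoint (M i) (s.biUnion M) := by
      rw [disjoint_biUnion_right]
      intro j hj
      exact hdisj i (mem_insert_self i s) j (mem_insert_of_mem hj) (fun h => hi (h ▸ hj))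
    have hW : (insert i s).biUnion M \ M i = s.biUnion M := by
      rw [biUnion_insert, union_sdiff_left, Finset.sdiff_eq_self_iff_disjoint]
      exact hd.symm
    refine F.gsum_nonneg_of_isModule_of_upper (hmod i (mem_insert_self i s)) ?_ (F.lab (M i))
      (fun X _ => F.lab_union_cases_of_lab_ne_zero (M i) X (hlab i (mem_insert_self i s))) ?_
    · rw [biUnion_insert]; exact subset_union_left
    · rw [hW]; exact ih'

/-- **★ₖ FOR STRUCTURES TILED BY NON-BOTTOM MODULES**: if the ground type is a disjoint union of modules `M i` with `lab (M i) ≠ 0`, then `0 ≤ ZK`.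
Every blow-up of the `m`-atom structure `θ_m` by monotone gadgets on pairwise disjoint territories (any number `m` of territories = colours) is of
this form: each territory is a module whose own label is its petal. [this work] -/
theorem ZK_nonneg_of_modules_cover [Fintype α] {ι : Type*} [DecidableEq ι] (s : Finset ι) (M : ι → Finset α) (g : ι → (Finset α → Bool))
    (hmod : ∀ i ∈ s, F.IsModule (M i) (g i)) (hlab : ∀ i ∈ s, F.lab (M i) ≠ 0)
    (hdisj : ∀ i ∈ s, ∀ j ∈ s, i ≠ j → Disjoint (M i) (M j)) (hcov : s.biUnion M = univ) : 0 ≤ F.ZK := by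
  rw [F.ZK_eq_gsum, ← hcov]
  exact F.gsum_biUnion_nonneg_of_modules s M g hmod hlab hdisj

end MSunflower

end Summit.CriticalPhenomena.PercolationContinuityZ3.Theorems.SunflowerPartition
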